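import Summits.FinalStateConjecture.FinalStateConjecture.Theorems.PhaseMixingCaptureCaptureSufficesTameNoC0Glue
import Summits.FinalStateConjecture.FinalStateConjecture.Theorems.PhaseMixingCaptureCaptureSufficesTameNoC0GlueOrient
import Summits.FinalStateConjecture.FinalStateConjecture.Theorems.PhaseMixingCaptureCaptureSufficesTameNoC0Limit
import Literature.Geometry.Lorentzian.KerrSliceFacts
import Literature.Geometry.Lorentzian.KerrPhotonOrbit
import Literature.Geometry.Lorentzian.KerrSchildFrame
import HarnessLib

/-!
# NoC0KerrChart: the Main Lemma (assembly)

Crux `CaptureSufficesTame` (stmt-FinalStateConjecture-17270), line `only-the-third-law-is-generic`, G's model point, lead c10.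
Registered sub-goal of this file: `stub_noC0_mainLemma` — the MAIN LEMMA of the NoC0KerrChart programme (the hypothesis of
`stub_noC0_reduction`): for `0 < M`, `0 ≤ a ≤ M` there are `R, T, ε₀ > 0` such that NO `C^∞` injective map `Φ` of the Kerr chunk
`{r₊ < r < R, |t*| < T}` into `E4` is an `ε₀`-isometry `‖Φ^*η − g_{M,a}‖ ≤ ε₀` throughout the chunk.

Proof (`NoC0.mainLemma`): take the retrograde photon orbit radius `r₀ ∈ [3M, 4M]` (`Kerr.exists_photonRadius`), `q = √(M/r₀³)`,
`e = 1 − aq ∈ (0, 1]`, `S = 2π/q`, `p₀ = Γ 0`; `R = 5M`, `T = 3S`; the anchor set `A` = one and a half revolutions of the orbit ∪ the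
static segment at `p₀` (compact, preconnected, inside the chunk `K`); `Ωg := thickening ρ A ⊆ K` (open, preconnected —
`isPreconnected_thickening`), `Ω' := thickening (ρ/2) A` (relatively compact in `Ωg`), `η₀ := ρ/4` (tubes inside `Ω'`, `H ≤ 2/5` on the
orbit tube since `r > 5M/2` there, `Kerr.abs_scalarH_le_of_mem_region`). If the Main Lemma failed, there would be `ε_n`-isometries
`Φ_n` of `K` with `ε_n = min (1/(n+1)) (1/80) → 0`; orient them (`stub_noC0_glueOrient` + `NoC0Glue.timeReflection_comp`), glue
(`stub_noC0_glue_oriented`, `d₁ = dist(p₀, Ω'ᶜ)/4` uniform in `n`), and contradict `stub_noC0_limitFalse`.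

References: J. Sbierski, J. Diff. Geom. 108 (2018) §3 / arXiv:1507.00601 (key `Sbierski2016AHP`); Anal. PDE 8 (2015) §7A (key `Sbierski2015`);
B. O'Neill, *Semi-Riemannian geometry* (1983), Ch. 14 (key `ONeillSemiRiemannian1983`).
-/

set_option linter.dupNamespace false
set_option maxSynthPendingDepth 3

noncomputable section

open Set Filter Function Metric
open scoped Topology ContDiff

namespace Summit.FinalStateConjecture.FinalStateConjecture.Theorems.PhaseMixingCaptureCaptureSufficesTame

open Literature.Geometry.Lorentzian

namespace NoC0

/-- Thickenings of preconnected sets are preconnected. [folklore] -/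
theorem isPreconnected_thickening {A : Set E4} (hA : IsPreconnected A) {δ : ℝ} (hδ : 0 < δ) :
    IsPreconnected (thickening δ A) := by
  apply isPreconnected_of_forall_pair
  intro x hx y hy
  rw [mem_thickening_iff] at hx hy
  obtain ⟨a₁, ha₁, hxa⟩ := hx
  obtain ⟨a₂, ha₂, hya⟩ := hy
  refine ⟨ball a₁ δ ∪ A ∪ ball a₂ δ, ?_, Or.inl (Or.inl (mem_ball.2 hxa)), Or.inr (mem_ball.2 hya), ?_⟩
  · exact union_subset (union_subset (ball_subset_thickening ha₁ δ) (self_subset_thickening hδ A))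
      (ball_subset_thickening ha₂ δ)
  · exact (((convex_ball a₁ δ).isPreconnected.union a₁ (mem_ball_self hδ) ha₁ hA).union a₂
      (Or.inr ha₂) (mem_ball_self hδ) (convex_ball a₂ δ).isPreconnected)

set_option maxHeartbeats 800000 in
/-- **The Main Lemma of NoC0KerrChart** (see the module docstring). [cite: Sbierski2016AHP, §3.2, proof of Thm. 12] -/
theorem mainLemma :
    ∀ (M a : ℝ), 0 < M → 0 ≤ a → a ≤ M → ∃ (R T ε₀ : ℝ), 0 < ε₀ ∧ ∀ Φ : E4 → E4,
      ContDiffOn ℝ ∞ Φ {x : E4 | Kerr.rPlus M a < Kerr.radius a x ∧ Kerr.radius a x < R ∧ -T < x 0 ∧ x 0 < T} →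
      InjOn Φ {x : E4 | Kerr.rPlus M a < Kerr.radius a x ∧ Kerr.radius a x < R ∧ -T < x 0 ∧ x 0 < T} →
      ∃ x : E4, (Kerr.rPlus M a < Kerr.radius a x ∧ Kerr.radius a x < R ∧ -T < x 0 ∧ x 0 < T) ∧
        ε₀ < ‖MetricCoord.pullMetric (fun _ ↦ Minkowski.bilin) Φ x - Kerr.bilin M a x‖ := by
  intro M a hM ha0 haM
  haveI : Kerr.Facts := ⟨Kerr.isConnected_region_holds, Kerr.contMDiff_bilin_holds, Kerr.contMDiff_timeVector_holds⟩
  haveI : Kerr.SliceFacts := Kerr.sliceFacts_holds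
  /- ── orbit data ── -/
  obtain ⟨r₀, h3, h4, hcubic⟩ := Kerr.exists_photonRadius hM (by nlinarith : a ^ 2 ≤ M ^ 2)
  have hr₀ : 0 < r₀ := by linarith
  obtain ⟨q, hq⟩ : ∃ q : ℝ, q = √(M / r₀ ^ 3) := ⟨_, rfl⟩
  have hq0' : 0 < q := by rw [hq]; positivity
  have hq2 : q ^ 2 * r₀ ^ 3 = M := by rw [hq, Real.sq_sqrt (by positivity)]; field_simp
  obtain ⟨e, he⟩ : ∃ e : ℝ, e = 1 - a * q := ⟨_, rfl⟩
  have haq : a * q < 1 := by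
    have h1 : (a * q) ^ 2 * r₀ ^ 3 = a ^ 2 * M := by rw [mul_pow, mul_assoc, hq2]
    have h2 : (3 * M) ^ 3 ≤ r₀ ^ 3 := pow_le_pow_left₀ (by linarith) h3 3
    have h3' : a ^ 2 * M ≤ M ^ 2 * M := mul_le_mul_of_nonneg_right (pow_le_pow_left₀ ha0 haM 2) hM.le
    have h4' : (a * q) ^ 2 * r₀ ^ 3 < 1 * r₀ ^ 3 := by nlinarith [pow_pos hM 3]
    have h5 : (a * q) ^ 2 < 1 := lt_of_mul_lt_mul_right h4' (pow_pos hr₀ 3).le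
    nlinarith [mul_nonneg ha0 hq0'.le]
  have he0 : 0 < e := by rw [he]; linarith
  have he1 : e ≤ 1 := by rw [he]; nlinarith [mul_nonneg ha0 hq0'.le]
  obtain ⟨S, hS⟩ : ∃ S : ℝ, S = 2 * Real.pi / q := ⟨_, rfl⟩
  have hS0 : 0 < S := by rw [hS]; positivity
  obtain ⟨p₀, hp₀⟩ : ∃ p₀ : E4, p₀ = Kerr.orbitCurve a r₀ q 0 := ⟨_, rfl⟩
  have hrp : Kerr.rPlus M a < r₀ := (Kerr.rPlus_le_two_mul hM.le).trans_lt (by linarith)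
  have hrp0 : 0 ≤ Kerr.rPlus M a := by unfold Kerr.rPlus; positivity
  have hcont₁ : Continuous (Kerr.orbitCurve a r₀ q) :=
    continuous_iff_continuousAt.2 fun s ↦ (Kerr.hasDerivAt_orbitCurve s).continuousAt
  have hcont₂ : Continuous (fun w : ℝ ↦ p₀ + w • E4.basisVector 0) := by fun_prop
  have hcoord : Continuous fun z : E4 ↦ z 0 := (EuclideanSpace.proj (0 : Fin 4)).continuous
  /- ── the anchor set and the chunk ── -/
  set A₁ : Set E4 := Kerr.orbitCurve a r₀ q '' Icc (-S) (2 * S) with hA₁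
  set A₂ : Set E4 := (fun w : ℝ ↦ p₀ + w • E4.basisVector 0) '' Icc 0 (2 * S) with hA₂
  have hA₁c : IsCompact A₁ := isCompact_Icc.image hcont₁
  have hA₂c : IsCompact A₂ := isCompact_Icc.image hcont₂
  have hAc : IsCompact (A₁ ∪ A₂) := hA₁c.union hA₂c
  have hp₀A₁ : p₀ ∈ A₁ := ⟨0, ⟨by linarith, by linarith⟩, hp₀.symm⟩
  have hp₀A₂ : p₀ ∈ A₂ := ⟨0, ⟨le_rfl, by linarith⟩, by simp⟩
  have hAconn : IsPreconnected (A₁ ∪ A₂) :=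
    (isPreconnected_Icc.image _ hcont₁.continuousOn).union p₀ hp₀A₁ hp₀A₂
      (isPreconnected_Icc.image _ hcont₂.continuousOn)
  -- the Kerr chunk of the Main Lemma and the auxiliary radial region
  set K : Set E4 := {x : E4 | Kerr.rPlus M a < Kerr.radius a x ∧ Kerr.radius a x < 5 * M ∧ -(3 * S) < x 0 ∧ x 0 < 3 * S}
    with hK
  have hKo : IsOpen K := by
    have h1 : IsOpen {x : E4 | Kerr.rPlus M a < Kerr.radius a x} := isOpen_lt continuous_const (Kerr.continuous_radius a)
    have h2 : IsOpen {x : E4 | Kerr.radius a x < 5 * M} := isOpen_lt (Kerr.continuous_radius a) continuous_const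
    have h3' : IsOpen {x : E4 | -(3 * S) < x 0} := isOpen_lt continuous_const hcoord
    have h4' : IsOpen {x : E4 | x 0 < 3 * S} := isOpen_lt hcoord continuous_const
    have : K = {x : E4 | Kerr.rPlus M a < Kerr.radius a x} ∩ {x : E4 | Kerr.radius a x < 5 * M} ∩
        {x : E4 | -(3 * S) < x 0} ∩ {x : E4 | x 0 < 3 * S} := by
      ext x; simp only [hK, mem_setOf_eq, mem_inter_iff]; tauto
    rw [this]
    exact ((h1.inter h2).inter h3').inter h4'
  have hKext : K ⊆ (Kerr.exterior M a : Set E4) := fun x hx ↦ by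
    rw [SetLike.mem_coe, Kerr.mem_exterior]
    exact max_lt hx.1 (hrp0.trans_lt hx.1)
  have htime₁ : ∀ s, Kerr.orbitCurve a r₀ q s 0 = e * s := fun s ↦ by rw [Kerr.orbitCurve_apply_zero, he]
  have hAK : A₁ ∪ A₂ ⊆ K := by
    rintro x (⟨s, hs, rfl⟩ | ⟨w, hw, rfl⟩)
    · refine ⟨by rw [Kerr.radius_orbitCurve hr₀]; exact hrp, by rw [Kerr.radius_orbitCurve hr₀]; linarith, ?_, ?_⟩
      · rw [htime₁]; nlinarith [hs.1, he0, he1]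
      · rw [htime₁]; nlinarith [hs.2, he0, he1]
    · have hrad : Kerr.radius a (p₀ + w • E4.basisVector 0) = r₀ := by
        rw [Kerr.radius_add_time_smul_basisVector, hp₀, Kerr.radius_orbitCurve hr₀]
      have ht0 : (p₀ + w • E4.basisVector 0) 0 = w := by
        rw [hp₀]
        simp [E4.basisVector]
      refine ⟨by rw [hrad]; exact hrp, by rw [hrad]; linarith, ?_, ?_⟩
      · rw [ht0]; linarith [hw.1]
      · rw [ht0]; linarith [hw.2]
  set K₃ : Set E4 := {x : E4 | 5 * M / 2 < Kerr.radius a x} with hK₃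
  have hK₃o : IsOpen K₃ := isOpen_lt continuous_const (Kerr.continuous_radius a)
  have hA₁K₃ : A₁ ⊆ K₃ := by
    rintro x ⟨s, hs, rfl⟩
    show 5 * M / 2 < Kerr.radius a (Kerr.orbitCurve a r₀ q s)
    rw [Kerr.radius_orbitCurve hr₀]; linarith
  obtain ⟨ρ₁, hρ₁, hρ₁K⟩ := hAc.exists_cthickening_subset_open hKo hAK
  obtain ⟨ρ₂, hρ₂, hρ₂K⟩ := hA₁c.exists_cthickening_subset_open hK₃o hA₁K₃
  obtain ⟨ρK, hρKdef⟩ : ∃ ρK : ℝ, ρK = min ρ₁ ρ₂ := ⟨_, rfl⟩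
  have hρK : 0 < ρK := by rw [hρKdef]; exact lt_min hρ₁ hρ₂
  have hρK1 : ρK ≤ ρ₁ := by rw [hρKdef]; exact min_le_left _ _
  have hρK2 : ρK ≤ ρ₂ := by rw [hρKdef]; exact min_le_right _ _
  set Ωg : Set E4 := thickening ρK (A₁ ∪ A₂) with hΩg
  set Ω' : Set E4 := thickening (ρK / 2) (A₁ ∪ A₂) with hΩ'
  have hΩgo : IsOpen Ωg := isOpen_thickening
  have hΩ'o : IsOpen Ω' := isOpen_thickening
  have hΩgK : Ωg ⊆ K := ((thickening_subset_cthickening _ _).trans (cthickening_mono hρK1 _)).trans hρ₁K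
  have hΩgext : Ωg ⊆ (Kerr.exterior M a : Set E4) := hΩgK.trans hKext
  have hΩgconn : IsPreconnected Ωg := isPreconnected_thickening hAconn hρK
  have hclΩ' : closure Ω' ⊆ Ωg :=
    (closure_thickening_subset_cthickening _ _).trans (cthickening_subset_thickening' hρK (by linarith) _)
  have hΩ'Ωg : Ω' ⊆ Ωg := subset_closure.trans hclΩ'
  have hcpt : IsCompact (closure Ω') :=
    (hAc.cthickening (r := ρK / 2)).of_isClosed_subset isClosed_closure (closure_thickening_subset_cthickening _ _)
  have hp₀Ω' : p₀ ∈ Ω' := self_subset_thickening (by positivity) _ (Or.inl hp₀A₁)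
  have hΩ'ext : closure Ω' ⊆ (Kerr.exterior M a : Set E4) := hclΩ'.trans hΩgext
  obtain ⟨η₀, hη₀def⟩ : ∃ η₀ : ℝ, η₀ = ρK / 4 := ⟨_, rfl⟩
  have hη₀ : 0 < η₀ := by rw [hη₀def]; positivity
  have hsub4 : ∀ A' ⊆ A₁ ∪ A₂, cthickening η₀ A' ⊆ Ω' := fun A' hA' ↦
    ((cthickening_subset_of_subset _ hA').trans (cthickening_subset_thickening' (by positivity) (by rw [hη₀def]; linarith) _))
  have htube : cthickening η₀ A₁ ⊆ Ω' := hsub4 A₁ subset_union_left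
  have hvert : cthickening η₀ A₂ ⊆ Ω' := hsub4 A₂ subset_union_right
  have hH : ∀ y ∈ cthickening η₀ A₁, Kerr.scalarH M a y ≤ 2 / 5 := by
    intro y hy
    have hy3 : y ∈ K₃ := hρ₂K (cthickening_mono (by rw [hη₀def]; linarith) _ hy)
    have hreg : y ∈ (Kerr.region a (5 * M / 2) : Set E4) := by
      rw [SetLike.mem_coe, Kerr.mem_region]; exact max_lt hy3 (lt_trans (by positivity) hy3)
    have h := Kerr.abs_scalarH_le_of_mem_region M (by positivity : (0:ℝ) < 5 * M / 2) hreg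
    rw [abs_of_pos hM] at h
    have : M / (5 * M / 2) = 2 / 5 := by field_simp
    linarith [le_abs_self (Kerr.scalarH M a y), this ▸ h]
  -- `d₁ := dist(p₀, Ω'ᶜ)/4 > 0`
  have hΩ'cne : (Ω'ᶜ : Set E4).Nonempty := by
    by_contra h
    rw [not_nonempty_iff_eq_empty, compl_empty_iff] at h
    have : IsCompact (closure Ω') := hcpt
    rw [h, closure_univ] at this
    exact noncompact_univ E4 this
  have hd₁ : 0 < infDist p₀ Ω'ᶜ / 4 := by
    have := (hΩ'o.isClosed_compl.notMem_iff_infDist_pos hΩ'cne).1 (fun h ↦ h hp₀Ω')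
    positivity
  /- ── the contradiction hypothesis: ε-isometries for every ε ── -/
  refine ⟨5 * M, 3 * S, ?_⟩
  by_contra H
  push Not at H
  have Hn : ∀ n : ℕ, ∃ Φ : E4 → E4, ContDiffOn ℝ ∞ Φ K ∧ InjOn Φ K ∧
      ∀ x : E4, (Kerr.rPlus M a < Kerr.radius a x ∧ Kerr.radius a x < 5 * M ∧ -(3 * S) < x 0 ∧ x 0 < 3 * S) →
        ‖MetricCoord.pullMetric (fun _ ↦ Minkowski.bilin) Φ x - Kerr.bilin M a x‖ ≤ min (1 / ((n : ℝ) + 1)) (1 / 80) :=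
    fun n ↦ H _ (lt_min (by positivity) (by norm_num))
  choose Φ hΦs hΦi hΦc using Hn
  -- orientation fix: compose with the time reflection of Minkowski space if necessary
  have hor : ∀ n : ℕ, ∃ Ψ : E4 → E4, ContDiffOn ℝ ∞ Ψ Ωg ∧ InjOn Ψ Ωg ∧
      (∀ y ∈ Ωg, ‖MetricCoord.pullMetric (fun _ ↦ Minkowski.bilin) Ψ y - Kerr.bilin M a y‖ ≤ min (1 / ((n : ℝ) + 1)) (1 / 80)) ∧
      (∀ y ∈ Ωg, ∀ v : E4, MetricCoord.pullMetric (fun _ ↦ Minkowski.bilin) Ψ y v v ≤ 0 → 0 < v 0 →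
        0 < (fderiv ℝ Ψ y v) 0) := by
    intro n
    have hs : ContDiffOn ℝ ∞ (Φ n) Ωg := (hΦs n).mono hΩgK
    have hi : InjOn (Φ n) Ωg := (hΦi n).mono hΩgK
    have hc : ∀ y ∈ Ωg, ‖MetricCoord.pullMetric (fun _ ↦ Minkowski.bilin) (Φ n) y - Kerr.bilin M a y‖ ≤
        min (1 / ((n : ℝ) + 1)) (1 / 80) := fun y hy ↦ hΦc n y (hΩgK hy)
    rcases stub_noC0_glueOrient M a Ωg (Φ n) (min (1 / ((n : ℝ) + 1)) (1 / 80)) hM.le hΩgo hΩgconn hΩgext hs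
      ((min_le_right _ _).trans_lt (by norm_num)) hc with hpos | hneg
    · exact ⟨Φ n, hs, hi, hc, hpos⟩
    · obtain ⟨hs', hi', hrefl⟩ := NoC0Glue.timeReflection_comp hΩgo hs
      refine ⟨_, hs', hi' hi, fun y hy ↦ by rw [(hrefl y hy).1]; exact hc y hy, fun y hy v hv hv0 ↦ ?_⟩
      rw [(hrefl y hy).2 v]
      have := hneg y hy v (by rw [← (hrefl y hy).1]; exact hv) hv0
      linarith
  choose Ψ hΨs hΨi hΨc hΨo using hor
  /- ── the glue, level by level ── -/
  set J : ℕ → Set E4 := fun n ↦ {Y | Y ∈ Ψ n '' Ω' ∧ (Y = Ψ n p₀ ∨ ∃ (γ : ℝ → E4) (a b : ℝ), a < b ∧ γ a = Ψ n p₀ ∧ γ b = Y ∧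
      ∀ t ∈ Set.Icc a b, γ t ∈ Ψ n '' Ω' ∧ ∃ v : E4, HasDerivAt γ v t ∧ Minkowski.bilin v v ≤ 0 ∧ 0 < v 0)} with hJ
  set C : ℕ → Set E4 := fun n ↦ Ω' ∩ Ψ n ⁻¹' closure (J n) with hC
  set O : ℕ → Set E4 := fun n ↦ Ω' ∩ Ψ n ⁻¹' interior (J n) with hO
  have hG := fun n ↦ stub_noC0_glue_oriented M a Ωg Ω' (Ψ n) (min (1 / ((n : ℝ) + 1)) (1 / 80)) p₀ hM.le hΩgo hΩgext hΩ'o hclΩ' hcpt hp₀Ω'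
    (hΨs n) (hΨi n) (le_min (by positivity) (by norm_num)) (min_le_right _ _) (hΨc n) (hΨo n) (J n) rfl (C n) (O n) rfl rfl
  have hε : Tendsto (fun n : ℕ ↦ min (1 / ((n : ℝ) + 1)) (1 / 80)) atTop (𝓝 0) := by
    have := tendsto_one_div_add_atTop_nhds_zero_nat.min (tendsto_const_nhds (x := (1 / 80 : ℝ)))
    rwa [min_eq_left (by norm_num : (0:ℝ) ≤ 1 / 80)] at this
  exact stub_noC0_limitFalse M a hM ha0 haM r₀ q e S h3 hcubic hq he hS p₀ hp₀ Ω' hΩ'ext hcpt η₀ hη₀ htube hH hvert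
    (infDist p₀ Ω'ᶜ / 4) hd₁ (fun n ↦ min (1 / ((n : ℝ) + 1)) (1 / 80)) (fun n ↦ le_min (by positivity) (by norm_num))
    (fun n ↦ min_le_right _ _) hε (fun n ↦ MetricCoord.pullMetric (fun _ ↦ Minkowski.bilin) (Ψ n))
    (fun n y hy ↦ hΨc n y (hΩ'Ωg hy)) C O (fun n ↦ (hG n).1) (fun n ↦ (hG n).2.1) (fun n ↦ (hG n).2.2.1)
    (fun n ↦ (hG n).2.2.2.1) (fun n ↦ (hG n).2.2.2.2.1) (fun n ↦ (hG n).2.2.2.2.2.1) (fun n ↦ (hG n).2.2.2.2.2.2.1)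
    (fun n ↦ (hG n).2.2.2.2.2.2.2.1) (fun n ↦ (hG n).2.2.2.2.2.2.2.2)

end NoC0

/-- **Registered sub-goal `stub_noC0_mainLemma`** (NoC0KerrChart programme, crux `CaptureSufficesTame`, line
`only-the-third-law-is-generic`): the Main Lemma — the hypothesis of `stub_noC0_reduction` — verbatim (`NoC0.mainLemma`).
[cite: Sbierski2016AHP, §3.2, proof of Thm. 12] -/
theorem stub_noC0_mainLemma :
    ∀ (M a : ℝ), 0 < M → 0 ≤ a → a ≤ M → ∃ (R T ε₀ : ℝ), 0 < ε₀ ∧ ∀ Φ : E4 → E4,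
      ContDiffOn ℝ ∞ Φ {x : E4 | Kerr.rPlus M a < Kerr.radius a x ∧ Kerr.radius a x < R ∧ -T < x 0 ∧ x 0 < T} →
      InjOn Φ {x : E4 | Kerr.rPlus M a < Kerr.radius a x ∧ Kerr.radius a x < R ∧ -T < x 0 ∧ x 0 < T} →
      ∃ x : E4, (Kerr.rPlus M a < Kerr.radius a x ∧ Kerr.radius a x < R ∧ -T < x 0 ∧ x 0 < T) ∧
        ε₀ < ‖MetricCoord.pullMetric (fun _ ↦ Minkowski.bilin) Φ x - Kerr.bilin M a x‖ :=
  NoC0.mainLemma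

end Summit.FinalStateConjecture.FinalStateConjecture.Theorems.PhaseMixingCaptureCaptureSufficesTame

end
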